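import Summits.CriticalPhenomena.PercolationContinuityZ3.Theorems.PercNearOneGluingNoHeavyQuantLowerTailGluing
import Summits.CriticalPhenomena.PercolationContinuityZ3.Theorems.PercNearOneGluingNoHeavyLowerTailOneCutFiveZeroOne
import Summits.CriticalPhenomena.PercolationContinuityZ3.Theorems.PercNearOneGluingNoHeavyLowerTailKNConj1Holds
import Summits.CriticalPhenomena.PercolationContinuityZ3.Theorems.PercNearOneGluingNoHeavyLowerTailHalfLeSevenForms
import HarnessLib

/-!
# QUANT lane R8: the observer-centred "far-relay row" (FAR) — one open row for every layer, implying the sharp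
# linear lower tail `Quant.QuantLowerTailGluing 1` and containing `OneCutFive.ZeroOneThree` as its layer-1 instance

builds on p205010 (kernel theorem, internal audit signed; external expert review pending)

Support file (`--supports stmt-CriticalPhenomena-4575`), QUANT lane lead (gen 4), rung R8 of `run/shared/lean/prim/quant/LADDER.md`;
memo `run/shared/lean/prim/quant/prim-quant-lead-g4/LEAD-NOTES-G4.md` N11.  One `Prop` definition (an OPEN row, tagged `@[conjecture]`),
three reduction theorems and the unconditional Markov (easy-regime) lemma; no sorries; standard axioms.

Vocabulary as in `Quant.QuantLowerTailGluingAt` / `OneCutFive.ZeroOneThree`: finite weighted graphs on `Fin n`, measure `prodBernoulli w`,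
events `openConn`, the relay count of the observer `N(ω) = #{a ∈ A | o ↔ a}` (the observer counts itself if `o ∈ A`) and its mean
`EN = Σ_{a∈A} P(o ↔ a)`.

* `Quant.FarRelayRow` — **(FAR)** for every finite weighted graph, vertex `o`, vertex set `A`, layer `j : ℕ` and `t`:
  `2j < Σ_{a∈A} P(o ↔ a)` and `P(o ↮ a) ≤ t` for all `a ∈ A` imply `P(N ≤ j) ≤ t`.  Equivalently
  `EN > 2j ⟹ P(N ≥ j+1) ≥ min_{a∈A} P(o ↔ a)`, equivalently (with `y` the least likely relay) the exchange inequality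
  `P(o ↔ y, N ≤ j) ≤ P(o ↮ y, N ≥ j+1)`.  The hypothesis sits at the OBSERVER (`EN_o > 2j`), not at a hub: this is what separates
  FAR from the refuted observer-free layer family `X′(k,j)` / `L(j)` / MINLOC (`SharpOneCut.levelTwoFinger_false`).  OPEN; census of the
  lead's second exact engine (partition-law DP, exact re-decision of every ratio ≥ 1 − 10⁻⁷): 0 violations on ALL connected graphs `n ≤ 7`
  × {½, ⅓–⅔, grid, skew, near-one, two-scale, heavy-star, light-pendant} palettes (26.4 M + 26.5 M placements, cells `o ∉ A` / `o ∈ A`;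
  sup `1 − 1.3·10⁻⁸` / `1 − 1.5·10⁻¹¹`, two-scale near-glue), on 18 000 blob-anatomy placements (V64/V66 mechanism, extremal pendant
  family) and under adversarial climbs (2 507 endpoints, sup `1 − 7·10⁻¹³`); `= 1` exactly only on weight-1 glue (e.g. `o` glued to `j` relays
  plus a glued blob of `j+1` relays behind a gate `g > j/(j+1)`).
* `Quant.zeroOneThree_of_farRelayRow` — the `|A| = 3`, `j = 1` instance of FAR is `OneCutFive.ZeroOneThree` (`Z(3,2)`) verbatim.
* `Quant.lntEN_sharp_of_farRelayRow` — **FAR ⟹ LNT♯-EN with constant one** (census form, both cells): if `P(a ↮ a') ≤ s` on `A × A` then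
  `P(1 ≤ N < EN/2) ≤ s · P(o ↔ A)`.  Proof: with `j = ⌈EN/2⌉ − 1` and `y` the least likely relay, FAR gives `P(N ≤ j) ≤ P(o ↮ y)`;
  subtract `P(N = 0) = P(o ↮ A)` and use KOZMA–NITZAN'S CONJECTURE 1 (tree theorem `kozmaNitzan2024_conjecture1_holds`):
  `P(o ↔ y) ≥ P(o ↔ A)(1 − s)`.
* `Quant.quantLowerTailGluing_one_of_farRelayRow` — hence **FAR ⟹ `Quant.QuantLowerTailGluing 1`** (the typed R8 target, sharp constant).
* `Quant.deficit_markov` / `Quant.farRelayRow_instance_of_markov` — the EASY (Markov) regime, unconditionally: `(|A| − j)·P(N ≤ j) ≤ Σ_a P(o ↮ a) = |A| − EN`,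
  so the FAR instance at `(A, o, j, t)` holds whenever `|A| − EN ≤ (|A| − j)·t`; FAR is open only in the complementary 'near-glued' regime
  `max_a P(o ↮ a) < (|A| − EN)/(|A| − j)` (e.g. `|A| = 3`, `j = 1`: all three `P(o ↔ a) > ½`, the W4 regime of P1-SURPLUS §12).
[cite: KozmaNitzan2024, Conj. 1 (p. 3), Lemma 2 (p. 6), Conjecture 3 (p. 15)]
-/

noncomputable section

namespace Summit.CriticalPhenomena.PercolationContinuityZ3.Theorems

open MeasureTheory Set
open Literature.Probability.LatticeModels (prodBernoulli)
open Literature.Probability.Percolation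
open scoped Classical

namespace Quant

/-- **(FAR) the far-relay row at layer `j`.**  For every finite weighted graph, vertex `o`, vertex set `A`, `j : ℕ` and `t : ℝ`:
if `2j < Σ_{a∈A} P(o ↔ a)` and `P(o ↮ a) ≤ t` for every `a ∈ A`, then `P(#{a ∈ A | o ↔ a} ≤ j) ≤ t` — "if the observer expects more
than `2j` relays, its cluster holds at most `j` of them no more often than it misses its least likely relay".  Layer `j = 1` with
`|A| = 3` is `OneCutFive.ZeroOneThree`; FAR implies `Quant.QuantLowerTailGluing 1` (`quantLowerTailGluing_one_of_farRelayRow`).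
OPEN (conjectured in this programme, QUANT lane lead gen 4; census-validated on all connected graphs n ≤ 7 × 9 palettes incl. heavy-star / light-pendant,
blob anatomies and adversarial climbs — 53 M placements, 0 violations; tight only on weight-1 glue).
builds on p205010 (kernel theorem, internal audit signed; external expert review pending).
[cite: KozmaNitzan2024, Lemma 2 (p. 6) (level 1 of this family), Conjecture 3 (p. 15)] [status: open] -/
@[conjecture] def FarRelayRow : Prop :=
  ∀ (n : ℕ) (w : Sym2 (Fin n) → unitInterval) (A : Finset (Fin n)) (o : Fin n) (j : ℕ) (t : ℝ),
    (2 * j : ℝ) < ∑ a ∈ A, (prodBernoulli w).real (openConn o a) →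
    (∀ a ∈ A, (prodBernoulli w).real (openConn o a)ᶜ ≤ t) →
    (prodBernoulli w).real {ω : BondConfig (Fin n) | (A.filter fun a => ω ∈ openConn o a).card ≤ j} ≤ t

/-- The layer-1, three-relay instance of FAR is `Z(3,2)` = `OneCutFive.ZeroOneThree` verbatim. [this work] -/
theorem zeroOneThree_of_farRelayRow (h : FarRelayRow) : OneCutFive.ZeroOneThree := by
  intro n w R o t _ hsum hcut
  exact h n w R o 1 t (by norm_num; exact hsum) hcut

variable {n : ℕ}

/-- **FAR ⟹ LNT♯-EN with constant one (census form, both cells).**  If `FarRelayRow` holds then on every finite weighted graph,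
for every vertex set `A`, vertex `o` and `s` with `P(a ↮ a') ≤ s` for all `a, a' ∈ A`:
`P(1 ≤ N ∧ N < EN/2) ≤ s · P(o ↔ A)`, `N = #{a ∈ A | o ↔ a}`, `EN = Σ_{a∈A} P(o ↔ a)`.
Uses Kozma–Nitzan's Conjecture 1 (tree theorem `kozmaNitzan2024_conjecture1_holds`) for the least likely relay.
[cite: KozmaNitzan2024, Conj. 1 (p. 3), Conjecture 3 (p. 15)] -/
theorem lntEN_sharp_of_farRelayRow (h : FarRelayRow) (n : ℕ) (w : Sym2 (Fin n) → unitInterval) (A : Finset (Fin n))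
    (o : Fin n) (s : ℝ)
    (hs : ∀ a ∈ A, ∀ a' ∈ A, (prodBernoulli w).real (openConn a a' : Set (BondConfig (Fin n)))ᶜ ≤ s) :
    (prodBernoulli w).real {ω : BondConfig (Fin n) | 1 ≤ (A.filter fun a => ω ∈ openConn o a).card ∧
        ((A.filter fun a => ω ∈ openConn o a).card : ℝ) <
          1 / 2 * ∑ a ∈ A, (prodBernoulli w).real (openConn o a)} ≤
      s * (prodBernoulli w).real (⋃ a ∈ A, openConn o a) := by
  set μ := prodBernoulli w with hμ
  have hmeas : ∀ S : Set (BondConfig (Fin n)), MeasurableSet S := fun S => (Set.toFinite S).measurableSet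
  set q : Fin n → ℝ := fun a => μ.real (openConn o a : Set (BondConfig (Fin n))) with hq
  set EN : ℝ := ∑ a ∈ A, q a with hEN
  set E : Set (BondConfig (Fin n)) := {ω | 1 ≤ (A.filter fun a => ω ∈ openConn o a).card ∧
      ((A.filter fun a => ω ∈ openConn o a).card : ℝ) < 1 / 2 * EN} with hE
  set U : Set (BondConfig (Fin n)) := ⋃ a ∈ A, openConn o a with hU
  show μ.real E ≤ s * μ.real U
  rcases A.eq_empty_or_nonempty with hAe | hne
  · -- no relays: the event is empty
    have hE0 : E = ∅ := by
      rw [Set.eq_empty_iff_forall_notMem]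
      intro ω hω
      obtain ⟨h1, -⟩ := hω
      rw [hAe, Finset.filter_empty, Finset.card_empty] at h1
      exact absurd h1 (by norm_num)
    have hU0 : U = ∅ := by rw [hU, hAe]; simp
    rw [hE0, hU0, measureReal_empty]; simp
  · -- `s ≥ 0` (take `a = a'`)
    obtain ⟨a₀, ha₀⟩ := hne
    have hs0 : 0 ≤ s := le_trans measureReal_nonneg (hs a₀ ha₀ a₀ ha₀)
    by_cases hEe : E = ∅
    · rw [hEe, measureReal_empty]; exact mul_nonneg hs0 measureReal_nonneg
    -- the event is nonempty, so `EN > 2 > 0`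
    obtain ⟨ω₀, hω₀⟩ := Set.nonempty_iff_ne_empty.2 hEe
    have hENpos : 0 < EN := by
      obtain ⟨h1, h2⟩ := hω₀
      have : (1 : ℝ) ≤ ((A.filter fun a => ω₀ ∈ openConn o a).card : ℝ) := by exact_mod_cast h1
      linarith
    -- the layer `j = ⌈EN/2⌉ − 1`: `2j < EN ≤ 2j + 2`
    set k : ℕ := ⌈EN / 2⌉₊ with hk
    have hk1 : 1 ≤ k := Nat.one_le_iff_ne_zero.2 (by rw [hk]; exact (Nat.ceil_pos.2 (by linarith)).ne')
    set j : ℕ := k - 1 with hj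
    have hjk : j + 1 = k := by omega
    have hjlt : (j : ℝ) < EN / 2 := by
      have : j < k := by omega
      rw [hk] at this
      exact Nat.lt_ceil.1 this
    have hle : EN / 2 ≤ (j : ℝ) + 1 := by
      have h' : EN / 2 ≤ (k : ℝ) := Nat.le_ceil _
      have : (k : ℝ) = (j : ℝ) + 1 := by rw [← hjk]; push_cast; ring
      linarith
    -- the least likely relay `y`
    obtain ⟨y, hyA, hy⟩ := A.exists_min_image q ⟨a₀, ha₀⟩
    -- FAR at layer `j` with `t = P(o ↮ y)`
    set S : Set (BondConfig (Fin n)) := {ω | (A.filter fun a => ω ∈ openConn o a).card ≤ j} with hS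
    have hcompl : ∀ a, μ.real (openConn o a : Set (BondConfig (Fin n)))ᶜ = 1 - q a := fun a =>
      probReal_compl_eq_one_sub (hmeas _)
    have hFAR : μ.real S ≤ 1 - q y := by
      have := h n w A o j (1 - q y) (by rw [← hμ]; linarith) fun a ha => by
        rw [← hμ, hcompl a]; linarith [hy a ha]
      rw [← hμ] at this
      exact this
    -- Kozma–Nitzan Conjecture 1 at the least likely relay: `P(o ↔ A)(1 − s) ≤ P(o ↔ y)`
    have hKN : μ.real U * (1 - s) ≤ q y := by
      have := kozmaNitzan2024_conjecture1_holds n w A o y (1 - s) fun a ha => by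
        have h1 := hs a ha y hyA
        have h2 : (prodBernoulli w).real (openConn a y : Set (BondConfig (Fin n)))ᶜ =
            1 - (prodBernoulli w).real (openConn a y : Set (BondConfig (Fin n))) := probReal_compl_eq_one_sub (hmeas _)
        linarith
      rw [← hμ] at this
      exact this
    -- `E` and `{N = 0} = Uᶜ` are disjoint subsets of `S`
    have hEsub : E ⊆ S := by
      intro ω hω
      obtain ⟨-, h2⟩ := hω
      have : ((A.filter fun a => ω ∈ openConn o a).card : ℝ) < (j : ℝ) + 1 := by linarith
      have : (A.filter fun a => ω ∈ openConn o a).card < j + 1 := by exact_mod_cast this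
      show (A.filter fun a => ω ∈ openConn o a).card ≤ j
      omega
    have hZsub : Uᶜ ⊆ S := by
      intro ω hω
      have h0 : (A.filter fun a => ω ∈ openConn o a).card = 0 := by
        rw [Finset.card_eq_zero, Finset.filter_eq_empty_iff]
        intro a ha hωa
        exact hω (Set.mem_biUnion (Finset.mem_coe.2 ha) hωa)
      show (A.filter fun a => ω ∈ openConn o a).card ≤ j
      omega
    have hdisj : Disjoint E Uᶜ := by
      rw [Set.disjoint_left]
      intro ω hω hωU
      obtain ⟨h1, -⟩ := hω
      obtain ⟨a, ha⟩ := Finset.card_pos.1 h1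
      rw [Finset.mem_filter] at ha
      exact hωU (Set.mem_biUnion (Finset.mem_coe.2 ha.1) ha.2)
    have hsum : μ.real E + μ.real Uᶜ ≤ μ.real S := by
      rw [← measureReal_union hdisj (hmeas _)]
      exact measureReal_mono (Set.union_subset hEsub hZsub) (measure_ne_top _ _)
    have hUc : μ.real Uᶜ = 1 - μ.real U := probReal_compl_eq_one_sub (hmeas _)
    -- assemble: `μ(E) ≤ μ(S) − μ(Uᶜ) ≤ (1 − q y) − (1 − μ U) = μ U − q y ≤ s μ U`
    nlinarith [hsum, hUc, hFAR, hKN]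

/-- **FAR ⟹ the sharp typed R8 target `Quant.QuantLowerTailGluing 1`**: `P(1 ≤ N < EN/2) ≤ 1·(P(o ↮ A) + s)` on every finite
weighted graph (from `lntEN_sharp_of_farRelayRow`, since `s·P(o ↔ A) ≤ s ≤ P(o ↮ A) + s`). [cite: KozmaNitzan2024, Conjecture 3 (p. 15)] -/
theorem quantLowerTailGluing_one_of_farRelayRow (h : FarRelayRow) : Quant.QuantLowerTailGluing 1 := by
  intro n w A o s _ hs0 hs
  have hmain := lntEN_sharp_of_farRelayRow h n w A o s hs
  have hU : (prodBernoulli w).real (⋃ a ∈ A, openConn o a : Set (BondConfig (Fin n))) ≤ 1 := measureReal_le_one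
  have hUc : 0 ≤ (prodBernoulli w).real (⋃ a ∈ A, openConn o a : Set (BondConfig (Fin n)))ᶜ := measureReal_nonneg
  have : s * (prodBernoulli w).real (⋃ a ∈ A, openConn o a : Set (BondConfig (Fin n))) ≤ s := by nlinarith
  linarith

/-- **Markov bound on the relay deficit** (every finite weighted graph, any `o`, `A`, `j`): `(|A| − j)·P(N ≤ j) ≤ Σ_{a∈A} P(o ↮ a)`
(`= |A| − EN`), since on `{N ≤ j}` at least `|A| − j` relays are missed. [folklore; first-moment counting] -/
theorem deficit_markov (n : ℕ) (w : Sym2 (Fin n) → unitInterval) (A : Finset (Fin n)) (o : Fin n) (j : ℕ) :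
    ((A.card : ℝ) - j) * (prodBernoulli w).real {ω : BondConfig (Fin n) | (A.filter fun a => ω ∈ openConn o a).card ≤ j} ≤
      ∑ a ∈ A, (prodBernoulli w).real (openConn o a : Set (BondConfig (Fin n)))ᶜ := by
  set μ := prodBernoulli w with hμ
  have hmeas : ∀ S : Set (BondConfig (Fin n)), MeasurableSet S := fun S => (Set.toFinite S).measurableSet
  set S : Set (BondConfig (Fin n)) := {ω | (A.filter fun a => ω ∈ openConn o a).card ≤ j} with hS
  have hcount : ((A.card : ℝ) - j) * μ.real S ≤
      ∑ a ∈ A, μ.real (S ∩ (openConn o a : Set (BondConfig (Fin n)))ᶜ) := by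
    refine halfLeSevenForms_mul_measureReal_le_sum_inter μ A
      (fun a => (openConn o a : Set (BondConfig (Fin n)))ᶜ) (fun a _ => hmeas _) (hmeas S) ((A.card : ℝ) - j)
      fun ω hω => ?_
    rw [← halfLeSevenForms_card_filter_eq_sum_indicator]
    have hsplit := Finset.card_filter_add_card_filter_not (s := A) (fun a => ω ∈ openConn o a)
    have hle : (A.filter fun a => ω ∈ openConn o a).card ≤ j := hω
    have hcast : ((A.filter fun a => ω ∈ openConn o a).card : ℝ) +
        ((A.filter fun a => ¬ ω ∈ openConn o a).card : ℝ) = A.card := by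
      exact_mod_cast hsplit
    have hrw : ((A.filter fun a => ω ∈ (openConn o a : Set (BondConfig (Fin n)))ᶜ).card : ℝ) =
        ((A.filter fun a => ¬ ω ∈ openConn o a).card : ℝ) := rfl
    have hlej : ((A.filter fun a => ω ∈ openConn o a).card : ℝ) ≤ j := by exact_mod_cast hle
    rw [hrw]
    linarith
  have hterm : ∀ a ∈ A, μ.real (S ∩ (openConn o a : Set (BondConfig (Fin n)))ᶜ) ≤
      μ.real (openConn o a : Set (BondConfig (Fin n)))ᶜ :=
    fun a _ => measureReal_mono Set.inter_subset_right (measure_ne_top _ _)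
  exact hcount.trans (Finset.sum_le_sum hterm)

/-- **FAR in the easy (Markov) regime, unconditionally**: the instance of `FarRelayRow` at `(A, o, j, t)` holds whenever
`Σ_{a∈A} P(o ↮ a) ≤ (|A| − j)·t` with `j < |A|` (no hypothesis on `EN` needed).  With `t = max_a P(o ↮ a)` this covers every
placement outside the 'near-glued' regime `max_a P(o ↮ a) < (|A| − EN)/(|A| − j)`. [folklore; first-moment counting] -/
theorem farRelayRow_instance_of_markov (n : ℕ) (w : Sym2 (Fin n) → unitInterval) (A : Finset (Fin n)) (o : Fin n) (j : ℕ)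
    (t : ℝ) (hjA : j < A.card)
    (ht : ∑ a ∈ A, (prodBernoulli w).real (openConn o a : Set (BondConfig (Fin n)))ᶜ ≤ ((A.card : ℝ) - j) * t) :
    (prodBernoulli w).real {ω : BondConfig (Fin n) | (A.filter fun a => ω ∈ openConn o a).card ≤ j} ≤ t := by
  have hpos : (0 : ℝ) < (A.card : ℝ) - j := by
    have : (j : ℝ) < A.card := by exact_mod_cast hjA
    linarith
  have h := (deficit_markov n w A o j).trans ht
  exact le_of_mul_le_mul_left h hpos

end Quant

end Summit.CriticalPhenomena.PercolationContinuityZ3.Theorems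

end
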